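import Summits.HodgeConjecture.CorCM.IrreducibleOddWeightsCertificateMultiplicity
import Mathlib.GroupTheory.SpecificGroups.Quaternion
import Mathlib.Algebra.Quaternion
import HarnessLib

/-!
# Wedderburn certificates VII: a worked certificate — the quaternion group `Q₈` on `ℍ_ℚ` (Schur index 2); every CM type
# of `Q₈` is nondegenerate, every family of them has rank `5`

COR-CM (cell `pub-hodgecm2`, binder seat `b16` gen 58, count-neutral claim CERTIFICATES, file F8 — a TEMPLATE showing that
the certificate hypotheses of F1–F3 are discharged by finite computation; theorems only, no definition, no named fact, no
`sorry`, no `native_decide`).  NEW as stated, hence under `Summits/`.  HONEST FRAMING: unconditional linear algebra about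
the rank of CM types on the quaternion group of order `8` (the Galois group of the quaternion octic CM fields, complex
conjugation = the central involution `a 2`); `HC_CM` is neither used nor asserted.

THE CERTIFICATE.  `G = QuaternionGroup 2 = {a i, xa i : i ∈ ℤ/4}` (Mathlib), `ρ = a 2` (central, `ρ² = 1`).  ONE odd
representation: `V = Z = ℍ_ℚ` (Hamilton quaternions over `ℚ`, a division ring), `G` acting by RIGHT multiplication
`π(g) v = v · q(g⁻¹)` with `q(a i) = I^i`, `q(xa i) = J I^i` (so `Z = ℍ_ℚ` acts on the LEFT, `Z`-linearly: `r = 1`, `d = 4`,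
`2 · r · d = 8 = |G|`).  The homomorphism property of `q` is checked by `decide` on integer quaternions, componentwise;
odd faithfulness reads the four coordinates of `Σ_g c(g) q(g⁻¹)`; `π(u_Ψ) =` right multiplication by
`β = Σ_g u_Ψ(g) q(g⁻¹)` with `re β = 2 u_Ψ(1) = ±2 ≠ 0`, hence invertible.

* **`typeRank_eq_five_of_quaternionGroup_two`** — EVERY CM type `Ψ ⊆ Q₈` (for `ρ = a 2`) has `rank(Ψ) = 5 = |G|/2 + 1`:
  all sixteen types are nondegenerate (Mai's criterion through the certificate, F3
  `typeRank_eq_iff_forall_range_eq_top_of_oddCertificate`).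
* **`typeRank_sigmaType_eq_five_of_quaternionGroup_two`** — EVERY non-empty family of CM types of `Q₈` has
  `rank(Σ) = 5`: `dim U(Σ) = r · dim_ℚ Σ_i range π(u_i) = dim_ℚ ℍ_ℚ = 4` (F3
  `finrank_antiSpan_sigmaType_eq_sum_finrank_range_of_oddCertificate`) — so two or more members are never additive
  (`Hg(A × A') ≠ Hg(A) × Hg(A')` for CM fourfolds with CM by one quaternion octic field, read through the tree's dictionaries).

## References

* [Serre1977] J.-P. Serre, *Linear Representations of Finite Groups*, GTM 42 (1977), §12.2 (the quaternion group:
  `ℚ[Q₈] ≅ ℚ⁴ × ℍ_ℚ`).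
* [Mai1989] L. Mai, *Lower bounds for the ranks of CM types*, J. Number Theory 32 (1989), §2 Prop. 1.
-/

set_option autoImplicit false

noncomputable section

open scoped BigOperators Quaternion

namespace Summit.HodgeConjecture.CorCM.IrrOdd

open Literature.NumberTheory.ComplexMultiplication
open QuaternionGroup

/-! ### §1 The certificate of `Q₈` -/

/-- **THE ODD CERTIFICATE OF `Q₈` ON `ℍ_ℚ`.**  There is a `ℚ`-representation `π` of `QuaternionGroup 2` on `ℍ_ℚ` by right
multiplications (`π(g) v = v · q(g⁻¹)`, `q(a i) = I^i`, `q(xa i) = J I^i`), commuting with LEFT multiplication by `ℍ_ℚ`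
(`r = 1`), with `π(a 2) = −1`, such that: the odd functions are faithful (`Σ_g c(g)π(g) = 0`, `c(a 2 · g) = −c(g)` ⟹ `c = 0`),
and for every CM type `Ψ` (for `ρ = a 2`) the operator `Σ_g u_Ψ(g) π(g)` is ONTO.  All by finite computation (`decide` on
integer quaternions, componentwise). [cite: Serre1977, §12.2] -/
theorem exists_oddCertificate_quaternionGroup_two :
    ∃ π : Representation ℚ (QuaternionGroup 2) ℍ[ℚ],
      (∀ (g : QuaternionGroup 2) (z v : ℍ[ℚ]), π g (z • v) = z • π g v) ∧
      (∀ v : ℍ[ℚ], π (a 2) v = -v) ∧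
      (∀ c : QuaternionGroup 2 → ℚ, (∀ g, c (a 2 * g) = -c g) → ∑ g, c g • π g = 0 → c = 0) ∧
      (∀ Ψ : Set (QuaternionGroup 2), IsCMTypeWith (a 2 : QuaternionGroup 2) Ψ →
        LinearMap.range (∑ g, antiVec Ψ (1 : QuaternionGroup 2) g • π g) = ⊤) := by
  classical
  -- the integer quaternion units `q(a i) = I^i`, `q(xa i) = J I^i`
  let F : QuaternionGroup 2 → ℍ[ℤ] := fun x => match x with
    | .a i => (⟨0, 1, 0, 0⟩ : ℍ[ℤ]) ^ i.val
    | .xa i => (⟨0, 0, 1, 0⟩ : ℍ[ℤ]) * (⟨0, 1, 0, 0⟩ : ℍ[ℤ]) ^ i.val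
  have hFmul' : ∀ g h : QuaternionGroup 2, (F (g * h)).re = (F g * F h).re ∧ (F (g * h)).imI = (F g * F h).imI ∧
      (F (g * h)).imJ = (F g * F h).imJ ∧ (F (g * h)).imK = (F g * F h).imK := by decide
  have hFmul : ∀ g h : QuaternionGroup 2, F (g * h) = F g * F h := fun g h =>
    Quaternion.ext _ _ (hFmul' g h).1 (hFmul' g h).2.1 (hFmul' g h).2.2.1 (hFmul' g h).2.2.2
  have hF1' : (F 1).re = 1 ∧ (F 1).imI = 0 ∧ (F 1).imJ = 0 ∧ (F 1).imK = 0 := by decide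
  -- the tables of `q(g⁻¹)`
  have hTre : ∀ g : QuaternionGroup 2, (F g⁻¹).re = (if g = a 0 then 1 else 0) - (if g = a 2 then 1 else 0) := by decide
  have hTI : ∀ g : QuaternionGroup 2, (F g⁻¹).imI = (if g = a 3 then 1 else 0) - (if g = a 1 then 1 else 0) := by decide
  have hTJ : ∀ g : QuaternionGroup 2, (F g⁻¹).imJ = (if g = xa 2 then 1 else 0) - (if g = xa 0 then 1 else 0) := by
    decide
  have hTK : ∀ g : QuaternionGroup 2, (F g⁻¹).imK = (if g = xa 1 then 1 else 0) - (if g = xa 3 then 1 else 0) := by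
    decide
  -- cast to `ℍ_ℚ`
  let cq : ℍ[ℤ] → ℍ[ℚ] := fun x => ⟨(x.re : ℚ), (x.imI : ℚ), (x.imJ : ℚ), (x.imK : ℚ)⟩
  have hcq_mul : ∀ x y : ℍ[ℤ], cq (x * y) = cq x * cq y := fun x y => by
    ext <;> simp [cq]
  have hcq1 : cq (F 1) = 1 := by
    ext <;> simp [cq, hF1'.1, hF1'.2.1, hF1'.2.2.1, hF1'.2.2.2]
  -- the representation by right multiplication with `q(g⁻¹)`
  let q : QuaternionGroup 2 → ℍ[ℚ] := fun g => cq (F g)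
  have hqmul : ∀ g h : QuaternionGroup 2, q (g * h) = q g * q h := fun g h => by
    change cq (F (g * h)) = cq (F g) * cq (F h)
    rw [hFmul, hcq_mul]
  have hq1 : q 1 = 1 := hcq1
  let π : Representation ℚ (QuaternionGroup 2) ℍ[ℚ] :=
    { toFun := fun g => LinearMap.mulRight ℚ (q g⁻¹)
      map_one' := LinearMap.ext fun v => by
        rw [LinearMap.mulRight_apply, inv_one, hq1, mul_one, Module.End.one_apply]
      map_mul' := fun g h => LinearMap.ext fun v => by
        rw [LinearMap.mulRight_apply, Module.End.mul_apply, LinearMap.mulRight_apply, LinearMap.mulRight_apply,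
          mul_inv_rev, hqmul, mul_assoc] }
  have hπ : ∀ (g : QuaternionGroup 2) (v : ℍ[ℚ]), π g v = v * q g⁻¹ := fun g v => rfl
  -- coordinates of `Σ_g c(g) q(g⁻¹)`
  have hsum_re : ∀ c : QuaternionGroup 2 → ℚ, (∑ g, c g • q g⁻¹).re = c (a 0) - c (a 2) := by
    intro c
    have e1 : (∑ g, c g • q g⁻¹).re = ∑ g, (c g • q g⁻¹).re :=
      map_sum (QuaternionAlgebra.reₗ (R := ℚ) (-1) 0 (-1)) (fun g => c g • q g⁻¹) Finset.univ
    have e2 : ∀ g, (q g⁻¹).re = ((if g = a 0 then 1 else 0) - (if g = a 2 then 1 else 0) : ℚ) := fun g => by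
      change ((F g⁻¹).re : ℚ) = _
      rw [hTre]; push_cast; rfl
    rw [e1]
    simp only [Quaternion.re_smul, smul_eq_mul, e2, mul_sub, mul_ite, mul_one, mul_zero, Finset.sum_sub_distrib,
      Finset.sum_ite_eq', Finset.mem_univ, if_true]
  have hsum_imI : ∀ c : QuaternionGroup 2 → ℚ, (∑ g, c g • q g⁻¹).imI = c (a 3) - c (a 1) := by
    intro c
    have e1 : (∑ g, c g • q g⁻¹).imI = ∑ g, (c g • q g⁻¹).imI :=
      map_sum (QuaternionAlgebra.imIₗ (R := ℚ) (-1) 0 (-1)) (fun g => c g • q g⁻¹) Finset.univ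
    have e2 : ∀ g, (q g⁻¹).imI = ((if g = a 3 then 1 else 0) - (if g = a 1 then 1 else 0) : ℚ) := fun g => by
      change ((F g⁻¹).imI : ℚ) = _
      rw [hTI]; push_cast; rfl
    rw [e1]
    simp only [Quaternion.imI_smul, smul_eq_mul, e2, mul_sub, mul_ite, mul_one, mul_zero, Finset.sum_sub_distrib,
      Finset.sum_ite_eq', Finset.mem_univ, if_true]
  have hsum_imJ : ∀ c : QuaternionGroup 2 → ℚ, (∑ g, c g • q g⁻¹).imJ = c (xa 2) - c (xa 0) := by
    intro c
    have e1 : (∑ g, c g • q g⁻¹).imJ = ∑ g, (c g • q g⁻¹).imJ :=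
      map_sum (QuaternionAlgebra.imJₗ (R := ℚ) (-1) 0 (-1)) (fun g => c g • q g⁻¹) Finset.univ
    have e2 : ∀ g, (q g⁻¹).imJ = ((if g = xa 2 then 1 else 0) - (if g = xa 0 then 1 else 0) : ℚ) := fun g => by
      change ((F g⁻¹).imJ : ℚ) = _
      rw [hTJ]; push_cast; rfl
    rw [e1]
    simp only [Quaternion.imJ_smul, smul_eq_mul, e2, mul_sub, mul_ite, mul_one, mul_zero, Finset.sum_sub_distrib,
      Finset.sum_ite_eq', Finset.mem_univ, if_true]
  have hsum_imK : ∀ c : QuaternionGroup 2 → ℚ, (∑ g, c g • q g⁻¹).imK = c (xa 1) - c (xa 3) := by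
    intro c
    have e1 : (∑ g, c g • q g⁻¹).imK = ∑ g, (c g • q g⁻¹).imK :=
      map_sum (QuaternionAlgebra.imKₗ (R := ℚ) (-1) 0 (-1)) (fun g => c g • q g⁻¹) Finset.univ
    have e2 : ∀ g, (q g⁻¹).imK = ((if g = xa 1 then 1 else 0) - (if g = xa 3 then 1 else 0) : ℚ) := fun g => by
      change ((F g⁻¹).imK : ℚ) = _
      rw [hTK]; push_cast; rfl
    rw [e1]
    simp only [Quaternion.imK_smul, smul_eq_mul, e2, mul_sub, mul_ite, mul_one, mul_zero, Finset.sum_sub_distrib,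
      Finset.sum_ite_eq', Finset.mem_univ, if_true]
  -- `(Σ_g c(g) π(g)) v = v · Σ_g c(g) q(g⁻¹)`
  have hop : ∀ (c : QuaternionGroup 2 → ℚ) (v : ℍ[ℚ]), (∑ g, c g • π g) v = v * ∑ g, c g • q g⁻¹ := by
    intro c v
    rw [LinearMap.sum_apply, Finset.mul_sum]
    refine Finset.sum_congr rfl fun g _ => ?_
    rw [LinearMap.smul_apply, hπ, mul_smul_comm]
  -- group facts
  have hρ2 : (a 2 : QuaternionGroup 2) * a 2 = 1 := by decide
  have hmul_tab : (a 2 : QuaternionGroup 2) * a 0 = a 2 ∧ (a 2 : QuaternionGroup 2) * a 1 = a 3 ∧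
      (a 2 : QuaternionGroup 2) * xa 0 = xa 2 ∧ (a 2 : QuaternionGroup 2) * xa 1 = xa 3 := by decide
  have hqρ : q (a 2)⁻¹ = -1 := by
    have h' : (F (a 2)⁻¹).re = -1 ∧ (F (a 2)⁻¹).imI = 0 ∧ (F (a 2)⁻¹).imJ = 0 ∧ (F (a 2)⁻¹).imK = 0 := by decide
    change cq (F (a 2)⁻¹) = -1
    ext <;> simp [cq, h'.1, h'.2.1, h'.2.2.1, h'.2.2.2]
  refine ⟨π, fun g z v => ?_, fun v => ?_, fun c hc h0 => ?_, fun Ψ hΨ => ?_⟩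
  · -- `ℍ_ℚ`-linearity (left scalars commute with right multiplication)
    rw [hπ, hπ, smul_eq_mul, smul_eq_mul, mul_assoc]
  · rw [hπ, hqρ, mul_neg, mul_one]
  · -- odd faithfulness: the four coordinates of `γ = Σ_g c(g) q(g⁻¹) = 0`, then oddness
    have hγ : ∑ g, c g • q g⁻¹ = 0 := by
      have := LinearMap.congr_fun h0 1
      rwa [hop, one_mul, LinearMap.zero_apply] at this
    have h1 : c (a 0) - c (a 2) = 0 := by rw [← hsum_re c, hγ]; rfl
    have h2 : c (a 3) - c (a 1) = 0 := by rw [← hsum_imI c, hγ]; rfl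
    have h3 : c (xa 2) - c (xa 0) = 0 := by rw [← hsum_imJ c, hγ]; rfl
    have h4 : c (xa 1) - c (xa 3) = 0 := by rw [← hsum_imK c, hγ]; rfl
    have o0 := hc (a 0)
    have o1 := hc (a 1)
    have o2 := hc (xa 0)
    have o3 := hc (xa 1)
    rw [hmul_tab.1] at o0
    rw [hmul_tab.2.1] at o1
    rw [hmul_tab.2.2.1] at o2
    rw [hmul_tab.2.2.2] at o3
    have hall : ∀ g : QuaternionGroup 2, g = a 0 ∨ g = a 1 ∨ g = a 2 ∨ g = a 3 ∨ g = xa 0 ∨ g = xa 1 ∨ g = xa 2 ∨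
        g = xa 3 := by decide
    funext g
    rw [Pi.zero_apply]
    rcases hall g with rfl | rfl | rfl | rfl | rfl | rfl | rfl | rfl <;> linarith
  · -- `Σ_g u_Ψ(g) π(g)` = right multiplication by `β` with `re β = 2 u_Ψ(1) ≠ 0`: onto
    set β : ℍ[ℚ] := ∑ g, antiVec Ψ (1 : QuaternionGroup 2) g • q g⁻¹ with hβ
    have hβre : β.re = 2 * antiVec Ψ (1 : QuaternionGroup 2) (a 0) := by
      rw [hβ, hsum_re]
      have hodd : antiVec Ψ (1 : QuaternionGroup 2) (a 2) = -antiVec Ψ (1 : QuaternionGroup 2) (a 0) := by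
        have := antiVec_mem_antiWeights hΨ (1 : QuaternionGroup 2)
        have h' := (mem_antiWeights_iff'.1 this) (a 0)
        rwa [smul_eq_mul, hmul_tab.1] at h'
      rw [hodd]; ring
    have hβ0 : β ≠ 0 := by
      intro h
      have h1 : β.re = 0 := by rw [h]; rfl
      rw [hβre] at h1
      have hu : antiVec Ψ (1 : QuaternionGroup 2) (a 0) = 1 ∨ antiVec Ψ (1 : QuaternionGroup 2) (a 0) = -1 := by
        unfold antiVec
        by_cases hm : (1 : QuaternionGroup 2) • (a 0 : QuaternionGroup 2) ∈ Ψ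
        · left; rw [translateInd_of_mem hm]; norm_num
        · right; rw [translateInd_of_not_mem hm]; norm_num
      rcases hu with hu | hu <;> rw [hu] at h1 <;> norm_num at h1
    rw [LinearMap.range_eq_top]
    intro v
    refine ⟨v * β⁻¹, ?_⟩
    rw [hop, ← hβ, mul_assoc, inv_mul_cancel₀ hβ0, mul_one]

/-! ### §2 Every CM type of `Q₈` is nondegenerate; every family has rank `5` -/

/-- **Every CM type of the quaternion group `Q₈ = QuaternionGroup 2` (conjugation `ρ = a 2`) is NONDEGENERATE:
`rank(Ψ) = 5 = |Q₈|/2 + 1`** — Mai's criterion through the quaternion certificate: `π(u_Ψ)` is right multiplication by a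
non-zero quaternion, hence invertible.  (For a Galois CM field with group `Q₈` every CM abelian fourfold `A_Ψ` has
`dim MT = 5`, hence `B• = D•` on all its powers, via the tree's dictionaries.) [cite: Mai1989, §2 Prop. 1] [cite: Serre1977, §12.2] -/
theorem typeRank_eq_five_of_quaternionGroup_two {Ψ : Set (QuaternionGroup 2)}
    (hΨ : IsCMTypeWith (a 2 : QuaternionGroup 2) Ψ) : typeRank (QuaternionGroup 2) Ψ = 5 := by
  classical
  obtain ⟨π, hlin, hodd, hfaith, hrange⟩ := exists_oddCertificate_quaternionGroup_two
  have hcard : Fintype.card (QuaternionGroup 2) = 8 := by rw [QuaternionGroup.card]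
  have hρ2 : (a 2 : QuaternionGroup 2) * a 2 = 1 := by decide
  have hcount : ∑ _k : Unit, Module.finrank ℍ[ℚ] ℍ[ℚ] * Module.finrank ℚ ℍ[ℚ] ≤
      Module.finrank ℚ (antiWeights (E := QuaternionGroup 2) (a 2 : QuaternionGroup 2)) := by
    have h1 := card_le_two_mul_finrank_antiWeights hΨ
    rw [hcard] at h1
    simp only [Finset.sum_const, Finset.card_univ, Fintype.card_unit, one_smul, Module.finrank_self, one_mul,
      Quaternion.finrank_eq_four]
    omega
  have h := typeRank_eq_iff_forall_range_eq_top_of_oddCertificate (K := Unit) (V := fun _ => ℍ[ℚ]) (Z := fun _ => ℍ[ℚ])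
    hΨ (fun _ => π) (fun _ g z v => hlin g z v) hρ2 (fun _ v => hodd v) hcount
    (fun c hc h0 => hfaith c hc (h0 ())) |>.2 fun _ => hrange Ψ hΨ
  rw [h, hcard]

/-- **Every non-empty FAMILY of CM types of `Q₈` has `rank(Σ) = 5`**: `dim U(Σ) = r · dim_ℚ (Σ_i range π(u_i)) =
dim_ℚ ℍ_ℚ = 4` — two or more members are never additive (for CM fourfolds `A, A'` with CM by one quaternion octic Galois CM
field, `dim Hg(A × A') = 4 < 8`, via the tree's dictionaries). [cite: Mai1989, §2 Prop. 1] [cite: Serre1977, §12.2] -/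
theorem typeRank_sigmaType_eq_five_of_quaternionGroup_two {I : Type} [Fintype I] [Nonempty I]
    {Ψ : I → Set (QuaternionGroup 2)} (hΨ : ∀ i, IsCMTypeWith (a 2 : QuaternionGroup 2) (Ψ i)) :
    typeRank (QuaternionGroup 2) (sigmaType (E := fun _ : I => QuaternionGroup 2) Ψ) = 5 := by
  classical
  obtain ⟨π, hlin, hodd, hfaith, hrange⟩ := exists_oddCertificate_quaternionGroup_two
  obtain ⟨i₀⟩ := ‹Nonempty I›
  haveI : Nonempty (Σ _ : I, QuaternionGroup 2) := ⟨⟨i₀, 1⟩⟩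
  have hcard : Fintype.card (QuaternionGroup 2) = 8 := by rw [QuaternionGroup.card]
  have hρ2 : (a 2 : QuaternionGroup 2) * a 2 = 1 := by decide
  have hcount : ∑ _k : Unit, Module.finrank ℍ[ℚ] ℍ[ℚ] * Module.finrank ℚ ℍ[ℚ] ≤
      Module.finrank ℚ (antiWeights (E := QuaternionGroup 2) (a 2 : QuaternionGroup 2)) := by
    have h1 := card_le_two_mul_finrank_antiWeights (hΨ i₀)
    rw [hcard] at h1
    simp only [Finset.sum_const, Finset.card_univ, Fintype.card_unit, one_smul, Module.finrank_self, one_mul,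
      Quaternion.finrank_eq_four]
    omega
  have hU := finrank_antiSpan_sigmaType_eq_sum_finrank_range_of_oddCertificate (K := Unit) (V := fun _ => ℍ[ℚ])
    (Z := fun _ => ℍ[ℚ]) Ψ hΨ (fun _ => π) (fun _ g z v => hlin g z v) hρ2 (fun _ v => hodd v) hcount
    (fun c hc h0 => hfaith c hc (h0 ()))
  -- every `range π(u_i)` is all of `ℍ_ℚ`
  have htop : (⨆ i, LinearMap.range (∑ g, antiVec (Ψ i) (1 : QuaternionGroup 2) g • π g) :
      Submodule ℚ ℍ[ℚ]) = ⊤ := by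
    rw [eq_top_iff, ← hrange (Ψ i₀) (hΨ i₀)]
    exact le_iSup (fun i => LinearMap.range (∑ g, antiVec (Ψ i) (1 : QuaternionGroup 2) g • π g)) i₀
  rw [(IsCMTypeWith.sigmaType (E := fun _ : I => QuaternionGroup 2) hΨ).typeRank_eq_finrank_antiSpan_add_one, hU]
  simp only [Finset.sum_const, Finset.card_univ, Fintype.card_unit, one_smul, Module.finrank_self, one_mul]
  rw [htop, finrank_top, Quaternion.finrank_eq_four]

end Summit.HodgeConjecture.CorCM.IrrOdd

end
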